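import Summits.ABC.IUTFork.Cor312ThetaFiniteMGood
import Summits.ABC.IUTFork.Cor312SettingMSharp
import Summits.ABC.IUTFork.Cor312PilotIdelesPadic
import HarnessLib

/-!
# [IUTchIII] Corollary 3.12, statement — "`−|log(Θ)|` is finite" AT THE M-LEVEL SHARP SETTING `settingMSharp`:
# `HullDefined`, the archimedean and good-place local Θ-volumes `= 0`, and `ThetaFinite`, with the Θ-box conditions DISCHARGED
# (G1-Θ unit P5b of `HOME/staging/w5/w5-d166/g4/G1-THETA-SHAPES.md`, C-lead ruling C-R12 (e) «target #2′»)

PROOF-ONLY record file (D-0012; no definitions, no `Prop` facts) of the abc-iut cell (R2 S-chain seat abc-iut-s2-p9,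
gen 0; branch C «abc ⇐ S»). TAKES NO SIDE on [IUTchIII] Cor. 3.12. Sequel of this seat's `Cor312ThetaFiniteM` /
`Cor312ThetaFiniteMGood` (unit P5a: `HullDefined`, arch-zero, good-place-zero and `ThetaFinite` for EVERY
`Cor312.Setting.ofFrames` over abc-iut-w5-d166's M-level field-box pieces `frameVolumePiecesOfInitialDH D hlog`, the Θ-boxes
a binder subject to three conditions). THIS file instantiates them at abc-iut-w5-d166's **`settingMSharp`**
(`Cor312SettingMSharp`, p435453: abc-iut-c312-6's `settingOfFrameVolumes` over those pieces with the SHARP Dupuy–Hilado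
Θ-boxes `thetaBoxM t` and the `q`-centre `qCentreM tq` READ OFF the Θ- and `q`-IDELES `t`, `tq` of the genuine completions `K_{v̲}`;
Dupuy–Hilado §3.7, §3.9, §4.10), discharging the three Θ-box conditions exactly as abc-iut-c312-7's
`Cor312PilotIdelesPrCapstone` (p424856) does at the F level — through abc-iut-s2-p8's GENERIC sharp-box layer
`Cor312PilotIdelesPadic` (p434901; `isHullSet_boxOf_sharpBox`, `boxOf_sharpBox_labelSucc_eq_hullSet_one`), to which
abc-iut-w5-d166's `sharpBoxM` is equal BY `rfl`:

* §1 `sharpBoxM_eq_sharpBox` / `thetaBoxM_non_eq` (the `rfl` bridges), `isHullSet_thetaBoxM_non` (every sharp Θ-box is a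
  hull-set `λ_Θ·𝒪_L` — [IUTchIII] Rmk. 3.9.5 (ix): the Θ-pilot object is an arithmetic line bundle; hence BOUNDED and
  NONDEGENERATE), `thetaBoxM_labelSucc_eq_hullSet_one` (unit Θ-ideles at `(i, u)` ⇒ the box at `(i+1, u)` is `𝒪_L`);
* §2 at `settingMSharp`: **`hullDefined_settingMSharp`** (every `(j, v_ℚ)`), `thetaLocal_ne_top_settingMSharp`,
  `thetaHull_adm_settingMSharp`, **`thetaLocal_settingMSharp_arc = 0`**, **`thetaLocal_settingMSharp_eq_zero`** (at a finite
  place `u ∉ S_Θ` with `p_u > 2`, `p_u ∤ disc(K)`, for Θ-ideles that are units off the finite set `S_Θ` of rational places —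
  [IUTchIV] Thm. 1.10 Step (vi)), and **`thetaFinite_settingMSharp`** ("`−|log(Θ)| ∈ ℝ`", the first clause of Cor. 3.12)
  — hence `negLogTheta_settingMSharp_ne_top`. These are exactly the inputs `ThetaFinite` / «arch `= 0`» / «vanishing off a
  finite set of places» of abc-iut-w5-d166's generic Θ-side reduction `negLogTheta_le_sum_add` (`Cor312ThetaSideReduction`,
  p432344) for unit P6; `BridgeHyps` is deliberately NOT produced here (at the field-box container `image_adm` is not a
  box statement; the hull-level comparison of P6 needs only `logvolMono_settingMSharp`).

[claim: Mochizuki2012, status: disputed] for the quoted setting; [cite: DupuyHilado2025, §3.7, §3.9, §4.10];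
[cite: Mochizuki2012, IUTchIII Rmk. 3.9.5 (ix) p. 128]; [cite: Mochizuki2012, IUTchIV Thm 1.10 proof Step (vi) p. 29].
HONEST FRAMING: bookkeeping at the genuine carriers for idele BINDERS `t`, `tq` (abc-iut-S2's genuine `I.tΘ`/`I.tq` are
instances, unit P7); nothing here bears on the truth of [IUTchIII] Cor. 3.12 (`Cor312.Setting.Statement` untouched);
typed ≠ proved; instantiated ≠ endorsed.
-/

noncomputable section

open Set Function NumberField IsDedekindDomain Bornology
open scoped Pointwise

namespace Summit.ABC.IUTFork.Thm311.Real

open Cor312 Cor312Vol Literature.IUT.LogThetaLattice Literature.IUT.LogVolume Literature.IUT.HodgeTheaters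
  Literature.NumberTheory.NumberFields

variable {F K Fbar : Type} [Field F] [NumberField F] [Field K] [NumberField K] [Algebra F K]
  [Field Fbar] [Algebra F Fbar] [Algebra K Fbar] {E : WeierstrassCurve F} [E.IsElliptic] {l : ℕ}
  {Pb : BadPlacePredicates K} (D : InitialThetaData F K Fbar E l Pb) {logvK : PadicLogsVal K}
  (hlog : LogvAnalyticVal logvK)

/-! ## §1. The sharp Θ-boxes of `settingMSharp` are hull-sets; `𝒪_L` where the Θ-ideles are units -/

section Boxes

variable
  (t : ∀ (u : FinitePlace ℚ) (_ : Fin (thetaIndexOfInitial D).lstar) (x : (thetaIndexOfInitial D).Fibre (Val.non u)),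
    kOfM D (ratChar u) u (natCast_ratChar_mem u) x)

/-- abc-iut-w5-d166's sharp summand region IS abc-iut-s2-p8's generic `PadicPresentation.sharpBox` of the presentation
`presAtM D hlog u` and the idele family `t u` (same formula `ι_j(t_{Θ,j,v̲_j})·(R_I)^∼`; by `rfl`). [cite: DupuyHilado2025, §3.9] -/
theorem sharpBoxM_eq_sharpBox (u : FinitePlace ℚ) (j : (thetaIndexOfInitial D).Label) :
    sharpBoxM D hlog t u j = (presAtM D hlog u).sharpBox (t u) j :=
  rfl

/-- At a finite place the Θ-box of `settingMSharp` IS the generic box of the generic sharp regions (by `rfl`).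
[cite: DupuyHilado2025, §4.10] -/
theorem thetaBoxM_non_eq (j : (thetaIndexOfInitial D).Label) (u : FinitePlace ℚ) :
    thetaBoxM D hlog t j (Val.non u) = (presAtM D hlog u).boxOf ((presAtM D hlog u).sharpBox (t u) j) :=
  rfl

/-- **Every sharp Θ-box at a finite place is a hull-set `λ_Θ·𝒪_L`** for non-zero Θ-ideles ([IUTchIII] Rmk. 3.9.5 (ix): the
Θ-pilot object is an arithmetic line bundle; abc-iut-s2-p8's `isHullSet_boxOf_sharpBox`).
[cite: Mochizuki2012, IUTchIII Rmk. 3.9.5 (ix) p. 128] -/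
theorem isHullSet_thetaBoxM_non (ht0 : ∀ u i x, t u i x ≠ 0) (j : (thetaIndexOfInitial D).Label) (u : FinitePlace ℚ) :
    IsHullSet (factorFieldM D hlog j (Val.non u)) (thetaBoxM D hlog t j (Val.non u)) :=
  (presAtM D hlog u).isHullSet_boxOf_sharpBox (t u) (ht0 u) j

/-- **Where the Θ-ideles of the label are units, the sharp Θ-box is the unit polydisc `𝒪_L`** (a hull-set depends only on
the norms of its centre; abc-iut-s2-p8's `boxOf_sharpBox_labelSucc_eq_hullSet_one`; Dupuy–Hilado §3.9 "`𝒪_{v⃗}` at the good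
places"). [cite: DupuyHilado2025, §3.9] -/
theorem thetaBoxM_labelSucc_eq_hullSet_one (ht0 : ∀ u i x, t u i x ≠ 0) (i : Fin (thetaIndexOfInitial D).lstar)
    (u : FinitePlace ℚ) (h1 : ∀ x : (thetaIndexOfInitial D).Fibre (Val.non u), ‖t u i x‖ = 1) :
    thetaBoxM D hlog t (Setting.labelSucc i) (Val.non u) =
      hullSet (factorFieldM D hlog (Setting.labelSucc i) (Val.non u)) (fun _ => 1) :=
  (presAtM D hlog u).boxOf_sharpBox_labelSucc_eq_hullSet_one (t u) (ht0 u) i h1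

/-- The union over the Kummer index of the (constant) sharp Θ-boxes is the sharp Θ-box (Dupuy–Hilado §4.10: the sharp
(Ind3)-datum does not depend on `m`). [cite: DupuyHilado2025, §4.10] -/
theorem iUnion_thetaBoxM (j : (thetaIndexOfInitial D).Label) (vQ : (thetaIndexOfInitial D).VQ) :
    (⋃ _m : ℤ, thetaBoxM D hlog t j vQ) = thetaBoxM D hlog t j vQ :=
  Set.iUnion_const _

/-- Hence the union over `m` of the sharp Θ-boxes at a finite place is BOUNDED … [cite: DupuyHilado2025, §4.10] -/
theorem isBounded_iUnion_thetaBoxM_non (ht0 : ∀ u i x, t u i x ≠ 0) (j : (thetaIndexOfInitial D).Label)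
    (u : FinitePlace ℚ) : Bornology.IsBounded (⋃ _m : ℤ, thetaBoxM D hlog t j (Val.non u)) := by
  rw [iUnion_thetaBoxM]
  exact (isHullSet_thetaBoxM_non D hlog t ht0 j u).isBounded

/-- … and NONDEGENERATE. [cite: DupuyHilado2025, §4.10] -/
theorem isNondegenerate_iUnion_thetaBoxM_non (ht0 : ∀ u i x, t u i x ≠ 0) (j : (thetaIndexOfInitial D).Label)
    (u : FinitePlace ℚ) :
    IsNondegenerate (factorFieldM D hlog j (Val.non u)) (⋃ _m : ℤ, thetaBoxM D hlog t j (Val.non u)) := by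
  rw [iUnion_thetaBoxM]
  exact (isHullSet_thetaBoxM_non D hlog t ht0 j u).isNondegenerate

end Boxes

/-! ## §2. At `settingMSharp`: `HullDefined`, arch-zero, good-place-zero, `ThetaFinite` -/

section Sharp

variable (M : Type) [Field M] [NumberField M]
  (archPk : ∀ (j : (thetaIndexOfInitial D).Label) (vQ : (thetaIndexOfInitial D).VQ),
    Set ((logShellsOfInitialDH D logvK).Packet j vQ))
  (archSub : ∀ (j : (thetaIndexOfInitial D).Label) (v : (thetaIndexOfInitial D).V),
    Set ((logShellsOfInitialDH D logvK).Packet j ((thetaIndexOfInitial D).over v)))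
  (Ψ : ℤ → ∀ v : (thetaIndexOfInitial D).V, v ∈ (thetaIndexOfInitial D).Vbad →
    Set ((logShellsOfInitialDH D logvK).StarPacket v))
  (act : ℤ → ∀ v : (thetaIndexOfInitial D).V, v ∈ (thetaIndexOfInitial D).Vbad →
    (logShellsOfInitialDH D logvK).StarPacket v → Module.End ℚ ((logShellsOfInitialDH D logvK).StarPacket v))
  (Mmod : ℤ → ∀ j : (thetaIndexOfInitial D).LabelStar, Set ((logShellsOfInitialDH D logvK).GlobalPacket j.1))
  (region : ℤ → ∀ j : (thetaIndexOfInitial D).LabelStar, FinDivisor M → ∀ vQ : (thetaIndexOfInitial D).VQ,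
    Set ((logShellsOfInitialDH D logvK).Packet j.1 vQ))
  (n : ℤ) {HT : Type} {LogLink : HT → HT → Type} {IsFull : ∀ {s t : HT}, LogLink s t → Prop}
  (lat : LGPGaussianLogThetaLattice LogLink IsFull)
  {Frd : Type} {IsoF : Frd → Frd → Type} {Ob : Frd → Type} {realify : Frd → Frd} {Strip : Type}
  {IsoS : Strip → Strip → Type} {Mv : ∀ v : (thetaIndexOfInitial D).V, v ∈ (thetaIndexOfInitial D).Vbad → Type}
  [∀ v h, Monoid (Mv v h)]
  (sig : GlobalLGPFrobenioidSignature (thetaIndexOfInitial D).lstar (thetaIndexOfInitial D).V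
    (· ∈ (thetaIndexOfInitial D).Vbad) Frd IsoF Ob realify Strip IsoS Mv)
  (split : SplittingMonoids Mv) {ObΔ : Type} {N : ∀ v : (thetaIndexOfInitial D).V, v ∈ (thetaIndexOfInitial D).Vbad → Type}
  [∀ v h, Monoid (N v h)] (qData : QPilotData ObΔ N)
  (t : ∀ (u : FinitePlace ℚ) (_ : Fin (thetaIndexOfInitial D).lstar) (x : (thetaIndexOfInitial D).Fibre (Val.non u)),
    kOfM D (ratChar u) u (natCast_ratChar_mem u) x)
  (tq : ∀ (u : FinitePlace ℚ) (x : (thetaIndexOfInitial D).Fibre (Val.non u)),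
    kOfM D (ratChar u) u (natCast_ratChar_mem u) x)
  (htq0 : ∀ u x, tq u x ≠ 0)
  (Sq : Finset (FinitePlace ℚ))
  (htq1 : ∀ (u : FinitePlace ℚ) (x : (thetaIndexOfInitial D).Fibre (Val.non u)), u ∉ Sq → ‖tq u x‖ = 1)
  (ht0 : ∀ u i x, t u i x ≠ 0)

include ht0 in
/-- **`HullDefined` at EVERY `(j, v_ℚ)` for the M-level sharp setting** (non-zero Θ-ideles): the sharp Θ-boxes are hull-sets
(bounded, nondegenerate) at every finite place, and the archimedean packet has empty factor index — unit P5a applies.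
[claim: Mochizuki2012, status: disputed] -/
theorem hullDefined_settingMSharp (j : (thetaIndexOfInitial D).Label) (vQ : (thetaIndexOfInitial D).VQ) :
    (settingMSharp D hlog M archPk archSub Ψ act Mmod region n lat sig split qData t tq htq0 Sq htq1).HullDefined j vQ :=
  hullDefined_ofFramesM D hlog M archPk archSub (frameVolumePiecesOfInitialDH D hlog).Adm
    (frameVolumePiecesOfInitialDH D hlog).logvol Ψ act Mmod region n lat sig split qData (fun _ _ => thetaBoxM D hlog t)
    (fun _ => qCentreM D hlog tq) (fun j vQ s => qCentreM_ne_zero D hlog tq htq0 j vQ s)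
    (FrameVolumePieces.hadm_of_realizes (S := situationMFrames D hlog M archPk archSub Ψ act Mmod region)
      (V := frameVolumePiecesOfInitialDH D hlog) (realizes_situationMFrames D hlog M archPk archSub Ψ act Mmod region n))
    (qSupport_finite_M D hlog M archPk archSub Ψ act Mmod region n qData tq Sq htq1) j
    (fun u => isBounded_iUnion_thetaBoxM_non D hlog t ht0 j u)
    (fun u => isNondegenerate_iUnion_thetaBoxM_non D hlog t ht0 j u) vQ

include ht0 in
/-- The local Θ-volume of the M-level sharp setting is a real number at every `(j, v_ℚ)`. [claim: Mochizuki2012, status: disputed] -/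
theorem thetaLocal_ne_top_settingMSharp (j : (thetaIndexOfInitial D).Label) (vQ : (thetaIndexOfInitial D).VQ) :
    (settingMSharp D hlog M archPk archSub Ψ act Mmod region n lat sig split qData t tq htq0 Sq htq1).thetaLocal j vQ ≠ ⊤ := by
  unfold Setting.thetaLocal
  rw [if_pos (hullDefined_settingMSharp D hlog M archPk archSub Ψ act Mmod region n lat sig split qData t tq htq0 Sq htq1
    ht0 j vQ)]
  exact WithTop.coe_ne_top

include ht0 in
/-- The hull `^{n,∘}𝒰_{j,v_ℚ}` of the M-level sharp setting is an admissible region of the field-box container.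
[claim: Mochizuki2012, status: disputed] -/
theorem thetaHull_adm_settingMSharp (j : (thetaIndexOfInitial D).Label) (vQ : (thetaIndexOfInitial D).VQ) :
    ((situationMFrames D hlog M archPk archSub Ψ act Mmod region).D n).Adm j vQ
      ((settingMSharp D hlog M archPk archSub Ψ act Mmod region n lat sig split qData t tq htq0 Sq htq1).thetaHull j vQ) :=
  (settingMSharp D hlog M archPk archSub Ψ act Mmod region n lat sig split qData t tq htq0 Sq htq1).thetaHull_adm
    (hullDefined_settingMSharp D hlog M archPk archSub Ψ act Mmod region n lat sig split qData t tq htq0 Sq htq1 ht0 j vQ)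

/-- **The ARCHIMEDEAN local Θ-volume of the M-level sharp setting is `0`** at every label (empty factor index; SHAPES unit
(A): the `((l+5)/4)·log π` of abc-iut-S2's genuine number is not seen by this container). [claim: Mochizuki2012, status: disputed] -/
theorem thetaLocal_settingMSharp_arc (j : (thetaIndexOfInitial D).Label) (w : InfinitePlace ℚ) :
    (settingMSharp D hlog M archPk archSub Ψ act Mmod region n lat sig split qData t tq htq0 Sq htq1).thetaLocal j
        (Val.arc w) = ((0 : ℝ) : WithTop ℝ) :=
  thetaLocal_ofFramesM_arc D hlog M archPk archSub (frameVolumePiecesOfInitialDH D hlog).Adm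
    (frameVolumePiecesOfInitialDH D hlog).logvol Ψ act Mmod region n lat sig split qData (fun _ _ => thetaBoxM D hlog t)
    (fun _ => qCentreM D hlog tq) (fun j vQ s => qCentreM_ne_zero D hlog tq htq0 j vQ s)
    (FrameVolumePieces.hadm_of_realizes (S := situationMFrames D hlog M archPk archSub Ψ act Mmod region)
      (V := frameVolumePiecesOfInitialDH D hlog) (realizes_situationMFrames D hlog M archPk archSub Ψ act Mmod region n))
    (qSupport_finite_M D hlog M archPk archSub Ψ act Mmod region n qData tq Sq htq1)
    (realizes_situationMFrames D hlog M archPk archSub Ψ act Mmod region n) j w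

include ht0 in
/-- **At a GOOD finite place where the Θ-ideles of the label are units, the local Θ-volume of the M-level sharp setting is
`0`** (`p_u > 2`, `p_u ∤ disc(K)`, `j = i+1 ∈ 𝔽_l^⋇`: the Θ-box is `𝒪_L`, the hull of ALL possible images is
`e⁻¹(Π_{v⃗} (R_{v⃗})^∼)` — [IUTchIV] Thm. 1.10 Step (vi) "the “container of possible images” is precisely equal to the
tensor product of log-shells"). [cite: Mochizuki2012, IUTchIV Thm 1.10 proof Step (vi) p. 29] -/
theorem thetaLocal_settingMSharp_eq_zero (i : Fin (thetaIndexOfInitial D).lstar) (u : FinitePlace ℚ)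
    (hp2 : 2 < ratChar u) (hdisc : ¬ ((ratChar u : ℕ) : ℤ) ∣ NumberField.discr K)
    (h1 : ∀ x : (thetaIndexOfInitial D).Fibre (Val.non u), ‖t u i x‖ = 1) :
    (settingMSharp D hlog M archPk archSub Ψ act Mmod region n lat sig split qData t tq htq0 Sq htq1).thetaLocal
        (Setting.labelSucc i) (Val.non u) = ((0 : ℝ) : WithTop ℝ) :=
  thetaLocal_ofFramesM_eq_zero D hlog M archPk archSub (frameVolumePiecesOfInitialDH D hlog).Adm
    (frameVolumePiecesOfInitialDH D hlog).logvol Ψ act Mmod region n lat sig split qData (fun _ _ => thetaBoxM D hlog t)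
    (fun _ => qCentreM D hlog tq) (fun j vQ s => qCentreM_ne_zero D hlog tq htq0 j vQ s)
    (FrameVolumePieces.hadm_of_realizes (S := situationMFrames D hlog M archPk archSub Ψ act Mmod region)
      (V := frameVolumePiecesOfInitialDH D hlog) (realizes_situationMFrames D hlog M archPk archSub Ψ act Mmod region n))
    (qSupport_finite_M D hlog M archPk archSub Ψ act Mmod region n qData tq Sq htq1)
    (realizes_situationMFrames D hlog M archPk archSub Ψ act Mmod region n) i u hp2 hdisc
    (by rw [iUnion_thetaBoxM]; exact thetaBoxM_labelSucc_eq_hullSet_one D hlog t ht0 i u h1)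

include ht0 in
/-- At a good finite place where the Θ-ideles of the label are units, the hull of the union of ALL possible images of the
M-level sharp setting IS `e⁻¹(Π_{v⃗} (R_{v⃗})^∼) = e⁻¹(𝒪_L)` (unit P5a `thetaHull_ofFramesM_eq_of_good`).
[cite: Mochizuki2012, IUTchIV Thm 1.10 proof Step (vi) p. 29] -/
theorem thetaHull_settingMSharp_eq_of_good (i : Fin (thetaIndexOfInitial D).lstar) (u : FinitePlace ℚ)
    (hp2 : 2 < ratChar u) (hdisc : ¬ ((ratChar u : ℕ) : ℤ) ∣ NumberField.discr K)
    (h1 : ∀ x : (thetaIndexOfInitial D).Fibre (Val.non u), ‖t u i x‖ = 1) :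
    (settingMSharp D hlog M archPk archSub Ψ act Mmod region n lat sig split qData t tq htq0 Sq htq1).thetaHull
        (Setting.labelSucc i) (Val.non u) =
      (presAtM D hlog u).latticePk (Setting.labelSucc i) 1 :=
  thetaHull_ofFramesM_eq_of_good D hlog M archPk archSub (frameVolumePiecesOfInitialDH D hlog).Adm
    (frameVolumePiecesOfInitialDH D hlog).logvol Ψ act Mmod region n lat sig split qData (fun _ _ => thetaBoxM D hlog t)
    (fun _ => qCentreM D hlog tq) (fun j vQ s => qCentreM_ne_zero D hlog tq htq0 j vQ s)
    (FrameVolumePieces.hadm_of_realizes (S := situationMFrames D hlog M archPk archSub Ψ act Mmod region)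
      (V := frameVolumePiecesOfInitialDH D hlog) (realizes_situationMFrames D hlog M archPk archSub Ψ act Mmod region n))
    (qSupport_finite_M D hlog M archPk archSub Ψ act Mmod region n qData tq Sq htq1) i u hp2 hdisc
    (by rw [iUnion_thetaBoxM]; exact thetaBoxM_labelSucc_eq_hullSet_one D hlog t ht0 i u h1)

variable
  /- the Θ-ideles are units off a finite set of rational places (e.g. those under `𝕍^bad_mod`) -/
  (Sθ : Finset (FinitePlace ℚ))
  (ht1 : ∀ (u : FinitePlace ℚ) (i : Fin (thetaIndexOfInitial D).lstar) (x : (thetaIndexOfInitial D).Fibre (Val.non u)),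
    u ∉ Sθ → ‖t u i x‖ = 1)

include ht0 ht1 in
/-- **`ThetaFinite` ("`−|log(Θ)| ∈ ℝ`", the first clause of [IUTchIII] Cor. 3.12) for the M-LEVEL sharp setting over the
genuine carriers `K_{v̲}`**, for non-zero Θ-ideles that are units off a finite set `S_Θ` of rational places: the three Θ-box
conditions of unit P5a are DISCHARGED (hull-set boxes; `𝒪_L` off `S_Θ`). The M-level twin of abc-iut-c312-7's
`thetaFinite_settingPrVolSharp` (p424856). [claim: Mochizuki2012, status: disputed] -/
theorem thetaFinite_settingMSharp :
    (settingMSharp D hlog M archPk archSub Ψ act Mmod region n lat sig split qData t tq htq0 Sq htq1).ThetaFinite :=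
  thetaFinite_ofFramesM D hlog M archPk archSub (frameVolumePiecesOfInitialDH D hlog).Adm
    (frameVolumePiecesOfInitialDH D hlog).logvol Ψ act Mmod region n lat sig split qData (fun _ _ => thetaBoxM D hlog t)
    (fun _ => qCentreM D hlog tq) (fun j vQ s => qCentreM_ne_zero D hlog tq htq0 j vQ s)
    (FrameVolumePieces.hadm_of_realizes (S := situationMFrames D hlog M archPk archSub Ψ act Mmod region)
      (V := frameVolumePiecesOfInitialDH D hlog) (realizes_situationMFrames D hlog M archPk archSub Ψ act Mmod region n))
    (qSupport_finite_M D hlog M archPk archSub Ψ act Mmod region n qData tq Sq htq1)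
    (realizes_situationMFrames D hlog M archPk archSub Ψ act Mmod region n)
    (fun i u => isBounded_iUnion_thetaBoxM_non D hlog t ht0 (Setting.labelSucc i) u)
    (fun i u => isNondegenerate_iUnion_thetaBoxM_non D hlog t ht0 (Setting.labelSucc i) u)
    (fun i => Sθ.finite_toSet.subset fun u hu => by
      by_contra hS
      exact hu (by rw [iUnion_thetaBoxM]; exact thetaBoxM_labelSucc_eq_hullSet_one D hlog t ht0 i u fun x => ht1 u i x hS))

include ht0 ht1 in
/-- Hence **`−|log(Θ)| ≠ +∞`** for the M-level sharp setting (abc-iut-c312-7's verbatim `negLogTheta`, `Cor312Statement`).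
[claim: Mochizuki2012, status: disputed] -/
theorem negLogTheta_settingMSharp_ne_top :
    (settingMSharp D hlog M archPk archSub Ψ act Mmod region n lat sig split qData t tq htq0 Sq htq1).negLogTheta ≠ ⊤ := by
  unfold Setting.negLogTheta
  rw [if_pos (thetaFinite_settingMSharp D hlog M archPk archSub Ψ act Mmod region n lat sig split qData t tq htq0 Sq htq1 ht0
    Sθ ht1)]
  exact WithTop.coe_ne_top

end Sharp

end Summit.ABC.IUTFork.Thm311.Real

end
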